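import Mathlib
import Literature.NumberTheory.Sieve.LevelOfDistribution
import Summits.Parity.GeneralizedHardyLittlewood.Theses.LiouvilleShiftedTables

/-!
# `PairsFromMAvg`, part 8: growth of the cut-offs `M₀ = ⌊N^ε⌋`, `D₁ = ⌊N/(M₀+1)⌋`

Route `LiouvilleShiftedTables` (Parity / GeneralizedHardyLittlewood), support item stmt-Parity-14275
(`PairsFromMAvg`). Elementary facts about the two cut-offs of the level-1 decomposition
(`0 < ε ≤ 1/2`): `M₀ ≤ N`, `D₁ ≤ N^{1-ε}`, `M₀ D₁ ≤ N`, eventually `D₁ ≥ 64` and `log N ≤ 4 log D₁`,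
`D₁ → ∞`; and the comparison scale `N/log N = o(N)`, `N^{1-ε} log N ≤ N/(log N)³` eventually.
[folklore]
-/

noncomputable section

open Finset Real Filter Asymptotics
open scoped Topology

namespace Summit.Parity.GeneralizedHardyLittlewood.Theorems.PairsFromMAvg

/-- `⌊N^ε⌋ ≤ N` for `0 < ε ≤ 1`. [folklore] -/
theorem floor_rpow_le_self {ε : ℝ} (hε0 : 0 < ε) (hε1 : ε ≤ 1) (N : ℕ) : ⌊(N : ℝ) ^ ε⌋₊ ≤ N := by
  rcases Nat.eq_zero_or_pos N with rfl | hN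
  · simp [Real.zero_rpow hε0.ne']
  · have hN1 : (1 : ℝ) ≤ N := by exact_mod_cast hN
    refine Nat.floor_le_of_le ?_
    calc (N : ℝ) ^ ε ≤ (N : ℝ) ^ (1 : ℝ) := Real.rpow_le_rpow_of_exponent_le hN1 hε1
      _ = N := Real.rpow_one _

/-- `⌊N^ε⌋ ≤ ⌊N^ε'⌋` for `0 < ε ≤ ε'`. [folklore] -/
theorem floor_rpow_mono {ε ε' : ℝ} (hε0 : 0 < ε) (hε : ε ≤ ε') (N : ℕ) :
    ⌊(N : ℝ) ^ ε⌋₊ ≤ ⌊(N : ℝ) ^ ε'⌋₊ := by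
  rcases Nat.eq_zero_or_pos N with rfl | hN
  · simp [Real.zero_rpow hε0.ne']
  · exact Nat.floor_le_floor (Real.rpow_le_rpow_of_exponent_le (by exact_mod_cast hN) hε)

/-- `D₁ = ⌊N/(⌊N^ε⌋+1)⌋ ≤ N^{1-ε}` (`0 < ε ≤ 1`). [folklore] -/
theorem cast_div_le_rpow (ε : ℝ) (N : ℕ) :
    ((N / (⌊(N : ℝ) ^ ε⌋₊ + 1) : ℕ) : ℝ) ≤ (N : ℝ) ^ (1 - ε) := by
  rcases Nat.eq_zero_or_pos N with rfl | hN
  · simp; positivity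
  have hN0 : (0 : ℝ) < N := by exact_mod_cast hN
  have hM : (N : ℝ) ^ ε < (⌊(N : ℝ) ^ ε⌋₊ : ℝ) + 1 := Nat.lt_floor_add_one _
  have hpow : 0 < (N : ℝ) ^ ε := Real.rpow_pos_of_pos hN0 ε
  calc ((N / (⌊(N : ℝ) ^ ε⌋₊ + 1) : ℕ) : ℝ) ≤ (N : ℝ) / ((⌊(N : ℝ) ^ ε⌋₊ + 1 : ℕ) : ℝ) := Nat.cast_div_le
    _ ≤ (N : ℝ) / (N : ℝ) ^ ε := by
        push_cast
        exact div_le_div_of_nonneg_left hN0.le hpow hM.le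
    _ = (N : ℝ) ^ (1 - ε) := by
        rw [Real.rpow_sub hN0, Real.rpow_one]

/-- `M · ⌊N/(M+1)⌋ ≤ N`. [folklore] -/
theorem cast_mul_div_le (N M : ℕ) : (M : ℝ) * ((N / (M + 1) : ℕ) : ℝ) ≤ N := by
  have h : M * (N / (M + 1)) ≤ N :=
    calc M * (N / (M + 1)) ≤ (M + 1) * (N / (M + 1)) := Nat.mul_le_mul_right _ (Nat.le_succ M)
      _ = N / (M + 1) * (M + 1) := mul_comm _ _
      _ ≤ N := Nat.div_mul_le_self N (M + 1)
  exact_mod_cast h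

/-- Lower bound `D₁ + 1 > N^{1-ε}/2` (`N ≥ 1`): from `(D₁+1)(M₀+1) > N` and `M₀ + 1 ≤ 2N^ε`. [folklore] -/
theorem rpow_div_two_lt_cast_div_add_one {ε : ℝ} (hε0 : 0 < ε) {N : ℕ} (hN : 1 ≤ N) :
    (N : ℝ) ^ (1 - ε) / 2 < ((N / (⌊(N : ℝ) ^ ε⌋₊ + 1) : ℕ) : ℝ) + 1 := by
  set M : ℕ := ⌊(N : ℝ) ^ ε⌋₊ with hM
  have hN0 : (0 : ℝ) < N := by exact_mod_cast hN
  have hN1 : (1 : ℝ) ≤ N := by exact_mod_cast hN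
  have hlt : N < N / (M + 1) * (M + 1) + (M + 1) := Nat.lt_div_mul_add (Nat.succ_pos M)
  have hlt' : (N : ℝ) < (((N / (M + 1) : ℕ) : ℝ) + 1) * ((M : ℝ) + 1) := by
    have : ((N : ℕ) : ℝ) < ((N / (M + 1) * (M + 1) + (M + 1) : ℕ) : ℝ) := by exact_mod_cast hlt
    push_cast at this
    linarith
  have hMle : (M : ℝ) ≤ (N : ℝ) ^ ε := Nat.floor_le (Real.rpow_nonneg hN0.le ε)
  have hpow1 : 1 ≤ (N : ℝ) ^ ε := Real.one_le_rpow hN1 hε0.le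
  have hM2 : (M : ℝ) + 1 ≤ 2 * (N : ℝ) ^ ε := by linarith
  have hpos : 0 < ((N / (M + 1) : ℕ) : ℝ) + 1 := by positivity
  -- `N < (D₁+1)(M+1) ≤ (D₁+1) 2N^ε`
  have h2 : (N : ℝ) < (((N / (M + 1) : ℕ) : ℝ) + 1) * (2 * (N : ℝ) ^ ε) :=
    lt_of_lt_of_le hlt' (mul_le_mul_of_nonneg_left hM2 hpos.le)
  rw [Real.rpow_sub hN0, Real.rpow_one, div_div, div_lt_iff₀ (by positivity)]
  linarith

/-- Eventually `D₁ ≥ 64` and `log N ≤ 4 log D₁` (`0 < ε ≤ 1/2`). [folklore] -/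
theorem eventually_div_large {ε : ℝ} (hε0 : 0 < ε) (hε : ε ≤ 1 / 2) :
    ∀ᶠ N : ℕ in atTop, 64 ≤ N / (⌊(N : ℝ) ^ ε⌋₊ + 1) ∧
      Real.log N ≤ 4 * Real.log ((N / (⌊(N : ℝ) ^ ε⌋₊ + 1) : ℕ) : ℝ) := by
  filter_upwards [eventually_ge_atTop (2 ^ 16)] with N hN
  set D : ℕ := N / (⌊(N : ℝ) ^ ε⌋₊ + 1) with hD
  have hN1 : 1 ≤ N := le_trans (by norm_num) hN
  have hN0 : (0 : ℝ) < N := by exact_mod_cast hN1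
  have hN1' : (1 : ℝ) ≤ N := by exact_mod_cast hN1
  have hlow := rpow_div_two_lt_cast_div_add_one hε0 hN1
  rw [← hD] at hlow
  -- `N^{1-ε} ≥ N^{1/2} ≥ 256`
  have hhalf : (N : ℝ) ^ (1 / 2 : ℝ) ≤ (N : ℝ) ^ (1 - ε) :=
    Real.rpow_le_rpow_of_exponent_le hN1' (by linarith)
  have h256 : (256 : ℝ) ≤ (N : ℝ) ^ (1 / 2 : ℝ) := by
    have : ((2 : ℝ) ^ 16) ≤ N := by exact_mod_cast hN
    calc (256 : ℝ) = ((2 : ℝ) ^ 16) ^ (1 / 2 : ℝ) := by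
          rw [← Real.rpow_natCast, ← Real.rpow_mul (by norm_num)]; norm_num
      _ ≤ (N : ℝ) ^ (1 / 2 : ℝ) := Real.rpow_le_rpow (by norm_num) this (by norm_num)
  have hD127 : (127 : ℝ) < D := by linarith
  have hD64 : 64 ≤ D := by exact_mod_cast (show (64 : ℝ) ≤ D by linarith)
  refine ⟨hD64, ?_⟩
  -- `D ≥ N^{1/2}/4`, so `4 log D ≥ 2 log N − 4 log 4 ≥ log N`
  have hD4 : (N : ℝ) ^ (1 / 2 : ℝ) / 4 ≤ D := by linarith
  have hDpos : (0 : ℝ) < D := by linarith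
  have hlogD : Real.log ((N : ℝ) ^ (1 / 2 : ℝ) / 4) ≤ Real.log D :=
    Real.log_le_log (by positivity) hD4
  rw [Real.log_div (by positivity) (by norm_num), Real.log_rpow hN0] at hlogD
  have hlogN : 0 ≤ Real.log N := Real.log_nonneg hN1'
  have hlog4 : Real.log 4 ≤ Real.log N / 8 := by
    have e : Real.log ((4 : ℝ) ^ 8) = 8 * Real.log 4 := by
      rw [Real.log_pow]; norm_num
    have : Real.log ((4 : ℝ) ^ 8) ≤ Real.log N :=
      Real.log_le_log (by norm_num) (by exact_mod_cast (le_trans (by norm_num) hN : 4 ^ 8 ≤ N))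
    linarith
  linarith

/-- `D₁ → ∞`. [folklore] -/
theorem tendsto_div_floor_rpow_atTop {ε : ℝ} (hε0 : 0 < ε) (hε : ε ≤ 1 / 2) :
    Tendsto (fun N : ℕ => N / (⌊(N : ℝ) ^ ε⌋₊ + 1)) atTop atTop := by
  rw [← tendsto_natCast_atTop_iff (R := ℝ)]
  have hlow : ∀ᶠ N : ℕ in atTop, (N : ℝ) ^ (1 / 2 : ℝ) / 2 - 1 ≤ ((N / (⌊(N : ℝ) ^ ε⌋₊ + 1) : ℕ) : ℝ) := by
    filter_upwards [eventually_ge_atTop 1] with N hN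
    have h1 := rpow_div_two_lt_cast_div_add_one hε0 hN
    have hhalf : (N : ℝ) ^ (1 / 2 : ℝ) ≤ (N : ℝ) ^ (1 - ε) :=
      Real.rpow_le_rpow_of_exponent_le (by exact_mod_cast hN) (by linarith)
    linarith
  refine tendsto_atTop_mono' atTop hlow ?_
  have h1 : Tendsto (fun N : ℕ => (N : ℝ) ^ (1 / 2 : ℝ)) atTop atTop :=
    (tendsto_rpow_atTop (by norm_num)).comp tendsto_natCast_atTop_atTop
  have h2 : Tendsto (fun N : ℕ => (N : ℝ) ^ (1 / 2 : ℝ) / 2) atTop atTop :=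
    h1.atTop_div_const (by norm_num)
  exact tendsto_atTop_add_const_right _ (-1) h2

/-- The comparison scale: `N/log N = o(N)`. [folklore] -/
theorem isLittleO_div_log_self :
    (fun N : ℕ => (N : ℝ) / Real.log N) =o[atTop] fun N : ℕ => (N : ℝ) := by
  have h1 : Tendsto (fun N : ℕ => (Real.log N)⁻¹) atTop (𝓝 0) :=
    (Real.tendsto_log_atTop.comp tendsto_natCast_atTop_atTop).inv_tendsto_atTop
  have h2 : (fun N : ℕ => (Real.log N)⁻¹) =o[atTop] fun _ : ℕ => (1 : ℝ) :=
    (isLittleO_one_iff ℝ).mpr h1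
  have h3 := h2.mul_isBigO (isBigO_refl (fun N : ℕ => (N : ℝ)) atTop)
  simp only [one_mul] at h3
  refine h3.congr' (Eventually.of_forall fun N => ?_) EventuallyEq.rfl
  show (Real.log N)⁻¹ * N = N / Real.log N
  rw [div_eq_inv_mul]

/-- Eventually `N^{1-ε} log N ≤ N/(log N)³` along the integers (the tree's
`rpow_mul_log_le_div_eventually`). [folklore] -/
theorem eventually_rpow_mul_log_le {ε : ℝ} (hε0 : 0 < ε) :
    ∀ᶠ N : ℕ in atTop, (N : ℝ) ^ (1 - ε) * Real.log N ≤ (N : ℝ) / Real.log N ^ 3 := by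
  have h := Literature.NumberTheory.Sieve.rpow_mul_log_le_div_eventually hε0 3
  filter_upwards [tendsto_natCast_atTop_atTop.eventually h] with N hN
  rwa [show (3 : ℝ) = ((3 : ℕ) : ℝ) by norm_num, Real.rpow_natCast] at hN

end Summit.Parity.GeneralizedHardyLittlewood.Theorems.PairsFromMAvg
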